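import Literature.Computability.QuantumComplexity.ShallowCircuits
import HarnessLib

/-!
# Quantum advantage with shallow circuits — injectivity of the input encoding (proofs)

Sibling "proofs" file of `Literature/Computability/QuantumComplexity/ShallowCircuits.lean`
(family `quantum-advantage`, statement **quantum-advantage.S23**). It discharges the named fact

* `Literature.Computability.QuantumComplexity.encodeHLF_injective_holds : encodeHLF_injective` —
  the input bit string `encodeHLF I` (entries of `A` on the ordered horizontal edges `hEdge k`,
  then on the ordered vertical edges `vEdge k`, then `b` in row-major order) determines a *valid*
  2D HLF instance `I = (A, b)` (`A` symmetric and supported on grid edges).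

This is the bookkeeping content of Bravyi–Gosset–König's parameterisation of the input
(arXiv p. 9–10, §3, text before Eq. (14)): "We require that `A_{v,w} = 0` unless the pair
`{v, w}` is an edge of `G`. We shall parameterize such a matrix by `|E|` binary variables
`A_e ∈ {0,1}` … The number of input bits in an instance of size `N` is then
`|V| + |E| = 3N² − 2N`" (here `inLen N = N(N-1) + N(N-1) + N²`). It is not a numbered statement
of the source.

## Proof

`b` is the third input block verbatim (`encodeHLF_natAdd`). For `A`: every ordered pair of
horizontally adjacent vertices `((i, j), (i, j+1))` is some `hEdge k` and every ordered pair of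
vertically adjacent vertices `((i, j), (i+1, j))` is some `vEdge k` (`exists_hEdge_eq`,
`exists_vEdge_eq`), so on these pairs the entries of `A` are input bits
(`encodeHLF_castAdd_castAdd`, `encodeHLF_castAdd_natAdd`); the reversed pairs follow by symmetry
of a valid `A`; and off the grid edges a valid `A` vanishes (`HLFInstance.IsValid.A_eq_false`).
The case split is Mathlib's `SimpleGraph.boxProd_adj` / `SimpleGraph.pathGraph_adj` for
`gridGraph N = pathGraph N □ pathGraph N`.

## References

* S. Bravyi, D. Gosset, R. König, *Quantum advantage with shallow circuits*, Science 362 (2018)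
  308–311, arXiv:1704.00690: §3, the paragraph before Eq. (14) and the definition "2D Hidden
  Linear Function Problem" (arXiv pp. 9–10), Theorem 1.
  [cite: BravyiGossetKonigScience2018, §3 Eq. (14)]
-/

namespace Literature.Computability.QuantumComplexity

open SimpleGraph

variable {N : ℕ}

/-! ### The three input blocks -/

/-- First input block: for `k < N(N-1)`, bit `k` of `encodeHLF I` is the entry of `A` on the
`k`-th ordered horizontal edge `hEdge k` (BGK: "`A` parameterized by `|E|` binary variables
`A_e`"). [cite: BravyiGossetKonigScience2018, §3 Eq. (14)] -/
theorem encodeHLF_castAdd_castAdd (I : HLFInstance N) (k : Fin (N * (N - 1))) :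
    encodeHLF I (Fin.castAdd (N * N) (Fin.castAdd (N * (N - 1)) k)) =
      I.A (hEdge k).1 (hEdge k).2 := by
  simp only [encodeHLF, Fin.append_left]

/-- Second input block: bit `N(N-1) + k` of `encodeHLF I` is the entry of `A` on the `k`-th
ordered vertical edge `vEdge k` (BGK: "`A` parameterized by `|E|` binary variables `A_e`").
[cite: BravyiGossetKonigScience2018, §3 Eq. (14)] -/
theorem encodeHLF_castAdd_natAdd (I : HLFInstance N) (k : Fin (N * (N - 1))) :
    encodeHLF I (Fin.castAdd (N * N) (Fin.natAdd (N * (N - 1)) k)) =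
      I.A (vEdge k).1 (vEdge k).2 := by
  simp only [encodeHLF, Fin.append_left, Fin.append_right]

/-- Third input block: bit `2N(N-1) + k` of `encodeHLF I` is `b` at the `k`-th grid vertex in
row-major order (BGK: the `|V|` input bits `b ∈ {0,1}^{|V|}`).
[cite: BravyiGossetKonigScience2018, §3 Eq. (14)] -/
theorem encodeHLF_natAdd (I : HLFInstance N) (k : Fin (N * N)) :
    encodeHLF I (Fin.natAdd (N * (N - 1) + N * (N - 1)) k) = I.b (finProdFinEquiv.symm k) := by
  simp only [encodeHLF, Fin.append_right]

/-! ### Ordered adjacent pairs are listed edges -/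

/-- Every ordered pair `((i, j), (i, j+1))` of horizontally adjacent grid vertices is an ordered
horizontal edge `hEdge k` (BGK's edges `{(i, j), (i, j+1)}` of the `N × N` grid, `|E| = 2N(N-1)`).
[cite: BravyiGossetKonigScience2018, §3 Eq. (14)] -/
theorem exists_hEdge_eq (u v : Fin N × Fin N) (h1 : u.1 = v.1) (h2 : u.2.val + 1 = v.2.val) :
    ∃ k : Fin (N * (N - 1)), (hEdge k).1 = u ∧ (hEdge k).2 = v := by
  obtain ⟨i, ⟨j, hj⟩⟩ := u
  obtain ⟨i', ⟨j', hj'⟩⟩ := v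
  simp only at h1 h2
  subst h1 h2
  exact ⟨finProdFinEquiv (i, ⟨j, by omega⟩), by simp [hEdge], by simp [hEdge]⟩

/-- Every ordered pair `((i, j), (i+1, j))` of vertically adjacent grid vertices is an ordered
vertical edge `vEdge k` (BGK's edges `{(i, j), (i+1, j)}` of the `N × N` grid, `|E| = 2N(N-1)`).
[cite: BravyiGossetKonigScience2018, §3 Eq. (14)] -/
theorem exists_vEdge_eq (u v : Fin N × Fin N) (h1 : u.2 = v.2) (h2 : u.1.val + 1 = v.1.val) :
    ∃ k : Fin (N * (N - 1)), (vEdge k).1 = u ∧ (vEdge k).2 = v := by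
  obtain ⟨⟨i, hi⟩, j⟩ := u
  obtain ⟨⟨i', hi'⟩, j'⟩ := v
  simp only at h1 h2
  subst h1 h2
  exact ⟨finProdFinEquiv (j, ⟨i, by omega⟩), by simp [vEdge], by simp [vEdge]⟩

/-! ### Valid instances are determined by their encoding -/

/-- For a valid instance, `A` vanishes off the grid edges (BGK: "We require that `A_{v,w} = 0`
unless the pair `{v, w}` is an edge of `G`"). [cite: BravyiGossetKonigScience2018, §3 Eq. (14)] -/
theorem HLFInstance.IsValid.A_eq_false {I : HLFInstance N} (hI : I.IsValid) {u v : Fin N × Fin N}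
    (huv : ¬ (gridGraph N).Adj u v) : I.A u v = false := by
  simpa using mt (hI.2 u v) huv

/-- Two valid instances with the same input encoding have the same matrix `A`: on grid edges in
increasing coordinate order the entries are input bits, the reversed order follows by symmetry,
and off the grid edges both vanish (BGK's parameterisation of `A` by the `|E|` bits `A_e`).
[cite: BravyiGossetKonigScience2018, §3 Eq. (14)] -/
theorem HLFInstance.IsValid.A_eq_of_encodeHLF_eq {I J : HLFInstance N} (hI : I.IsValid)
    (hJ : J.IsValid) (h : encodeHLF I = encodeHLF J) : I.A = J.A := by
  -- the entries on the listed ordered edges are input bits, hence agree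
  have hh : ∀ k : Fin (N * (N - 1)),
      I.A (hEdge k).1 (hEdge k).2 = J.A (hEdge k).1 (hEdge k).2 := fun k => by
    rw [← encodeHLF_castAdd_castAdd I k, ← encodeHLF_castAdd_castAdd J k, h]
  have hv : ∀ k : Fin (N * (N - 1)),
      I.A (vEdge k).1 (vEdge k).2 = J.A (vEdge k).1 (vEdge k).2 := fun k => by
    rw [← encodeHLF_castAdd_natAdd I k, ← encodeHLF_castAdd_natAdd J k, h]
  -- hence the entries agree on all ordered adjacent pairs in increasing coordinate order
  have hH : ∀ u v : Fin N × Fin N,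
      u.1 = v.1 → u.2.val + 1 = v.2.val → I.A u v = J.A u v := by
    intro u v h1 h2
    obtain ⟨k, hk1, hk2⟩ := exists_hEdge_eq u v h1 h2
    rw [← hk1, ← hk2]
    exact hh k
  have hV : ∀ u v : Fin N × Fin N,
      u.2 = v.2 → u.1.val + 1 = v.1.val → I.A u v = J.A u v := by
    intro u v h1 h2
    obtain ⟨k, hk1, hk2⟩ := exists_vEdge_eq u v h1 h2
    rw [← hk1, ← hk2]
    exact hv k
  funext u v
  by_cases hadj : (gridGraph N).Adj u v
  · rcases boxProd_adj.mp hadj with ⟨h1, h2⟩ | ⟨h1, h2⟩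
    · -- first coordinates adjacent on the path, second coordinates equal: a vertical edge
      rcases pathGraph_adj.mp h1 with h1 | h1
      · exact hV u v h2 h1
      · rw [hI.1 u v, hJ.1 u v]
        exact hV v u h2.symm h1
    · -- second coordinates adjacent on the path, first coordinates equal: a horizontal edge
      rcases pathGraph_adj.mp h1 with h1 | h1
      · exact hH u v h2 h1
      · rw [hI.1 u v, hJ.1 u v]
        exact hH v u h2.symm h1
  · rw [hI.A_eq_false hadj, hJ.A_eq_false hadj]

/-- Two instances with the same input encoding have the same vector `b` (it is the third input
block verbatim; BGK's `|V|` input bits `b`). [cite: BravyiGossetKonigScience2018, §3 Eq. (14)] -/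
theorem HLFInstance.b_eq_of_encodeHLF_eq {I J : HLFInstance N} (h : encodeHLF I = encodeHLF J) :
    I.b = J.b := by
  funext v
  have hv := congrFun h (Fin.natAdd (N * (N - 1) + N * (N - 1)) (finProdFinEquiv v))
  simpa only [encodeHLF_natAdd, Equiv.symm_apply_apply] using hv

/-- **Discharge of `encodeHLF_injective`.** The input encoding `encodeHLF` is injective on valid
2D HLF instances: `b` is listed verbatim, and a symmetric `A` supported on grid edges is
determined by its entries on the ordered edges `hEdge k`, `vEdge k` — Bravyi–Gosset–König's
parameterisation of the input `(A, b)` by `|E| + |V| = 3N² − 2N` bits (arXiv pp. 9–10, §3,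
before Eq. (14); a bookkeeping property of this tree's input layout, not a numbered statement of
the source). [cite: BravyiGossetKonigScience2018, §3 Eq. (14)] -/
theorem encodeHLF_injective_holds : encodeHLF_injective (N := N) := by
  intro I hI J hJ h
  rw [Set.mem_setOf_eq] at hI hJ
  have hA : I.A = J.A := hI.A_eq_of_encodeHLF_eq hJ h
  have hb : I.b = J.b := HLFInstance.b_eq_of_encodeHLF_eq h
  obtain ⟨IA, Ib⟩ := I
  obtain ⟨JA, Jb⟩ := J
  simp only at hA hb
  subst hA hb
  rfl

end Literature.Computability.QuantumComplexity
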